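import Summits.BirchSwinnertonDyer.BirchSwinnertonDyer.Theorems.PrintCf2SplitBadTwoControlCokernelTamagawa
import Summits.BirchSwinnertonDyer.BirchSwinnertonDyer.Theorems.PrintCf2SplitBadTwoRestrictedSelmerControlKernelExact
import Summits.BirchSwinnertonDyer.BirchSwinnertonDyer.Theorems.PrintCf2SplitBadTwoRestrictedSelmerCMSideConditions
import Summits.BirchSwinnertonDyer.BirchSwinnertonDyer.Theorems.GoldfeldAllTwistsTwoConverseTwinAdditiveTorsion
import HarnessLib

/-!
# Crux `PrintCf2.SplitBadTwoRankOneOfFacts` (stmt-BirchSwinnertonDyer-20368), road α v10.3 — THE LEAD'S ASSEMBLY OF S3c: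
# `stub_restrictedControl_two` (v9/v10.3 VERBATIM) FROM FIVE NAMED RESIDUALS, everything else being kernel theorems

Cell `bsd-print-cf2`, LEAD seat `bsd-line-cf2-p1` g12 (prover-bsd-line-cf2-p1-g12-0); `--supports stmt-BirchSwinnertonDyer-20368` (helper,
Theses-free). HONEST FRAMING: this file does NOT close the stub — it proves the registered statement of S3c from DISPLAYED HYPOTHESES (the
residuals below); nothing here is a named fact; BSD is not proved by any of this; no summit statement is proved by this seat. No definition,
no `sorry`. Its purpose is to make the residual structure of S3c KERNEL-PRECISE: every width brick of the cell (LEAD g11, -w2 … -w8, 2026-08-28)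
enters BY NAME, and what is left is exactly the list of hypotheses, each in the currency its owner lane produces.

THE ASSEMBLY (`restrictedControl_two_of_residuals`). For a member `C • W = cm7^{(d)}` and an S3c frame (`K` imaginary quadratic, `v ≠ v̄ ∣ 2`,
`π² = π − 2` `K`-rational, `r² = r − 2`, `M = W* := ↥((W.baseChange K).endEigenPrimaryTorsion 2 π r)` pinned at `v`, `κ'` unramified outside `v̄`
with topological generator `γ'`, a finitely generated `Λ`-dual datum `D` of `𝔖 = 𝔖_{v̄}(K*_∞, M)` with `D.HasCharValuationAt n`, a `ℚ`-generator
datum `P, c₀, ℓ`), with `T = {w : 2 ∉ w, 7d ∈ w}` (-w3 g7 `exists_finset_seven_mul`) and `LK_w = ker(H¹(D_w, M) → H¹(D_w ∩ Gal(K̄/K*_∞), M))`: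
 1. FOUR-INDEX IDENTITY, all four groups finite (-w7 `hasCharValuationAt_control_identity_endEigenPrimaryTorsion`, p652617-lineage):
    `n + v₂ #𝔖_Γ + v₂ #ker = v₂ #𝔖_{v̄}(K, M) + v₂ [𝔖^Γ : res 𝔖_{v̄}(K, M)]`.
 2. KERNEL `#ker = 1` (-w6 g2 `natCard_ker_control_of_frame_eq_one`, p661668-lineage) GRANTED (H7) «`w₇` does not split in the first layer of `K*_∞`».
 3. TOP `#𝔖_Γ = 1` — RESIDUAL (R-TOP) (brick B17, -w4 g8: reduced to the surjectivity of `conj_γ − (1+c)` on `𝔖`; `Module.Finite Λ D.X` is now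
    unconditional, `…RestrictedSelmerDualModuleFinite`).
 4. TAMAGAWA DICTIONARY `Σ_{w ∈ T} v₂ #LK_w + 2 = v₂ Tam(W)` for `7 ∤ d` (-w3 g8 `sum_padicValNat_localKer_top_of_frame_add_two_eq`: Greenberg LNM 1716
    Lemma 3.3 for the summand + c301's `Tam = 8·∏(2|4)` + the decomposition law of `ℚ(√−7)`) GRANTED (C1) «no `w ∈ T` splits completely in `K*_∞`»;
    `#W(ℚ)_tors = 2` (c301 `torsionOrder_eq_two_of_smul_eq_cm7_quadraticTwist`, `7 ∤ d`). The members with `7 ∣ d` — RESIDUAL (R-SEVEN), the S-sized twin.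
 5. DYADIC VALUE `v₂ #LK_{v̄} = e_{v̄}([d]₂)` — RESIDUAL (R-DYADIC) (brick B15, -w2 g9: exact `#W*(K_{v̄}) ∈ {2, 4}` by `d mod 8`, landed for `d ≢ 3 (8)`).
 6. LEVEL-`K` LAW — RESIDUAL (R-LEVELK), THE XL ONE (Poitou–Tate at level `K`, LEAD g12 memo `S3C-LEVELK-POITOU-TATE-TYPING-g12.md`; -w7 g2's
    bottom-value lane T1 + -w8 g2's B6e + the dyadic index T4):
    `v₂ #𝔖_{v̄}(K, M) + v₂ [𝔖^Γ : res] − Σ_{w ∈ T} v₂ #LK_w − v₂ #LK_{v̄} = v₂ #Ш(W/ℚ)[2^∞] + 2ℓ + e_K([d]₂)` (the EXACT cokernel's surjectivity defect and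
    the bottom value together — only their sum is claimed class-uniform, memo §2/§4).
 7. (H7) and (C1) are CLASS-FIELD-THEORETIC — RESIDUAL (R-CFT): for `K = ℚ(√−7)` and `K*_∞ ⊂ K(v̄^∞)`, `Frob_w ↦ α⁻¹ ∈ U_{v̄}/{±1} ≅ 1 + 4ℤ₂` for
    `w = (α)`, so no finite `w ∤ 2` splits completely (`α ≠ ±1`) and `w₇ = (√−7)` is inert in `K₁` (`√−7 ≢ ±1 (mod 8)`); de Shalit 1987 II.1 / Coates–Wiles:
    «every prime not above `𝔭` is finitely decomposed in `K(𝔭^∞)`» — a ty2 typing target (named fact), not provable without global reciprocity.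
 THEN `n = v₂ #Ш(W/ℚ)[2^∞] + v₂ Tam(W) − 2·v₂ #W(ℚ)_tors + 2ℓ + e_C([d]₂)` with `e_C := e_K + e_{v̄}` — S3c VERBATIM.
presearch: not applicable (assembly of tree theorems; no stub, no fact filed). beyond-print theorem: no.

References: [Agboola2007] §3 Prop. 3.2, §5, §6 Prop. 6.10–6.11, Prop. 8.1; [GreenbergLNM1716] §3 Lemmas 3.1–3.3, §4 Lemma 4.2; [deShalit1987] II.1.
-/

noncomputable section

open scoped Classical

set_option linter.dupNamespace false
set_option autoImplicit false

open NumberField IsDedekindDomain Field WeierstrassCurve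
open Literature.NumberTheory.EllipticCurves Literature.NumberTheory.EllipticCurves.GreenbergSelmer
open Literature.NumberTheory.EllipticCurves.Agboola2007
open Literature.NumberTheory.EllipticCurves.IwasawaAlgebra
open Literature.NumberTheory.EllipticCurves.IwasawaDual
open Literature.NumberTheory.EllipticCurves.ResKernel
open Literature.NumberTheory.GaloisRepresentations
open Summit.BirchSwinnertonDyer.BirchSwinnertonDyer.Theorems.PrintCf2.AdditiveAtSeven
open Summit.BirchSwinnertonDyer.BirchSwinnertonDyer.Theorems.GoldfeldGoodTwists

namespace Summit.BirchSwinnertonDyer.BirchSwinnertonDyer.Theorems.PrintCf2.RestrictedSelmerPair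

/-- **S3c `stub_restrictedControl_two` FROM THE NAMED RESIDUALS (R-CFT: C1, H7) (R-TOP) (R-DYADIC) (R-SEVEN) (R-LEVELK).** The conclusion is
the registered stub's statement VERBATIM (v9 = v10.3); the proof is items 1–7 of the module docstring. Each hypothesis is stated in the currency of
the lane that owns it, quantified over exactly the frame data it needs. [cite: Agboola2007, §3 Prop. 3.2, §5, §6, Prop. 8.1]
[cite: GreenbergLNM1716, §3 Lemmas 3.1–3.3, §4 Lemma 4.2] -/
theorem restrictedControl_two_of_residuals
    -- (R-CFT / C1) no odd place over `7d` splits completely in the line `K*_∞`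
    (hC1 : ∀ (K : Type) [Field K] [NumberField K], IsImaginaryQuadratic K →
      ∀ (vbar : HeightOneSpectrum (𝓞 K)), ((2 : ℕ) : 𝓞 K) ∈ vbar.asIdeal →
      ∀ (κ' : ZpExtension K 2), κ'.IsUnramifiedOutside vbar →
      ∀ (w : HeightOneSpectrum (𝓞 K)), ((2 : ℕ) : 𝓞 K) ∉ w.asIdeal → ¬ decomp w ≤ κ'.kerSubgroup)
    -- (R-CFT / H7) the place above `7` is inert in the first layer of `K*_∞`
    (hH7 : ∀ (K : Type) [Field K] [NumberField K], IsImaginaryQuadratic K →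
      ∀ (vbar : HeightOneSpectrum (𝓞 K)), ((2 : ℕ) : 𝓞 K) ∈ vbar.asIdeal →
      ∀ (κ' : ZpExtension K 2), κ'.IsUnramifiedOutside vbar →
      ∀ (w : HeightOneSpectrum (𝓞 K)), ((7 : ℕ) : 𝓞 K) ∈ w.asIdeal → ¬ decomp w ≤ κ'.layerSubgroup 1)
    -- (R-TOP) `#𝔖_Γ = 1` on every frame carrying a finitely generated dual datum with a characteristic valuation (brick B17)
    (hTop : ∀ (d : ℤ), d ≠ 0 → ∀ (W : WeierstrassCurve ℚ) [W.IsElliptic] (C : VariableChange ℚ),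
      C • W = cm7.quadraticTwist (d : ℚ) →
      ∀ (K : Type) [Field K] [NumberField K], IsImaginaryQuadratic K →
      ∀ (v vbar : HeightOneSpectrum (𝓞 K)),
        ((2 : ℕ) : 𝓞 K) ∈ v.asIdeal → ((2 : ℕ) : 𝓞 K) ∈ vbar.asIdeal → vbar ≠ v →
      ∀ (π : (W.baseChange K).endRing), (π : AddMonoid.End (W.baseChange K).geomPoints) * π = π - 2 →
      ∀ (r : ℤ_[2]), r * r = r - 2 →
        (∀ τ ∈ GreenbergSelmer.inertia v, ∀ x : ↥((W.baseChange K).endEigenPrimaryTorsion 2 π r), τ • x = x ∨ τ • x = -x) →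
      ∀ (κ' : ZpExtension K 2), κ'.IsUnramifiedOutside vbar → ∀ (γ' : absoluteGaloisGroup K), κ'.IsTopGenerator γ' →
      ∀ (D : Agboola2007.RestrictedDualData κ' ↥((W.baseChange K).endEigenPrimaryTorsion 2 π r) vbar γ') (n : ℕ),
        Module.Finite (IwasawaAlgebra 2) D.X → D.HasCharValuationAt n →
        Nat.card (EndCoinvariants
          (conjRestricted κ' ↥((W.baseChange K).endEigenPrimaryTorsion 2 π r) vbar γ' - 1)) = 1)
    -- (R-DYADIC) the local kernel at `v̄` is a function of the `2`-adic class of `d` (brick B15)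
    (hDy : ∃ ev : ℤ → ℤ → ℤ, ∀ (d : ℤ), d ≠ 0 → Squarefree d → d % 4 ≠ 1 →
      ∀ (W : WeierstrassCurve ℚ) [W.IsElliptic] (C : VariableChange ℚ), C • W = cm7.quadraticTwist (d : ℚ) →
      ∀ (K : Type) [Field K] [NumberField K], IsImaginaryQuadratic K →
      ∀ (v vbar : HeightOneSpectrum (𝓞 K)),
        ((2 : ℕ) : 𝓞 K) ∈ v.asIdeal → ((2 : ℕ) : 𝓞 K) ∈ vbar.asIdeal → vbar ≠ v →
      ∀ (π : (W.baseChange K).endRing), (π : AddMonoid.End (W.baseChange K).geomPoints) * π = π - 2 →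
      ∀ (r : ℤ_[2]), r * r = r - 2 →
        (∀ τ ∈ GreenbergSelmer.inertia v, ∀ x : ↥((W.baseChange K).endEigenPrimaryTorsion 2 π r), τ • x = x ∨ τ • x = -x) →
      ∀ (κ' : ZpExtension K 2), κ'.IsUnramifiedOutside vbar →
        (padicValNat 2 (Nat.card (resOfLe ↥((W.baseChange K).endEigenPrimaryTorsion 2 π r)
          (inf_le_inf_right (decomp vbar) (le_top : κ'.kerSubgroup ≤ ⊤))).ker) : ℤ) = ev (d % 2) ((d / (2 - d % 2)) % 8))
    -- (R-SEVEN) the Tamagawa dictionary and the torsion order for the members with `7 ∣ d` (c301's laws assume `7 ∤ d`)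
    (hSeven : ∀ (d : ℤ), Squarefree d → d % 4 ≠ 1 → (7 : ℤ) ∣ d →
      ∀ (W : WeierstrassCurve ℚ) [W.IsElliptic] (C : VariableChange ℚ), C • W = cm7.quadraticTwist (d : ℚ) →
      W.torsionOrder = 2 ∧
      ∀ (K : Type) [Field K] [NumberField K], IsImaginaryQuadratic K →
      ∀ (vbar : HeightOneSpectrum (𝓞 K)), ((2 : ℕ) : 𝓞 K) ∈ vbar.asIdeal →
      ∀ (π : (W.baseChange K).endRing), (π : AddMonoid.End (W.baseChange K).geomPoints) * π = π - 2 →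
      ∀ (r : ℤ_[2]), r * r = r - 2 → ∀ (κ' : ZpExtension K 2), κ'.IsUnramifiedOutside vbar →
      ∀ (T : Finset (HeightOneSpectrum (𝓞 K))),
        (∀ w : HeightOneSpectrum (𝓞 K), w ∈ T ↔ ((2 : ℕ) : 𝓞 K) ∉ w.asIdeal ∧ ((7 * d : ℤ) : 𝓞 K) ∈ w.asIdeal) →
        (∀ w ∈ T, ¬ decomp w ≤ κ'.kerSubgroup) →
        (∑ w ∈ T, padicValNat 2 (Nat.card (resOfLe ↥((W.baseChange K).endEigenPrimaryTorsion 2 π r)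
          (inf_le_inf_right (decomp w) (le_top : κ'.kerSubgroup ≤ ⊤))).ker)) + 2 = padicValNat 2 W.tamagawaProduct)
    -- (R-LEVELK) the level-`K` law: bottom value + exact cokernel minus the local kernels = `ord₂ #Ш(W/ℚ)[2^∞] + 2ℓ + e_K([d]₂)`
    (hLev : ∃ eK : ℤ → ℤ → ℤ, ∀ (d : ℤ), d ≠ 0 → Squarefree d → d % 4 ≠ 1 →
      ∀ (W : WeierstrassCurve ℚ) [W.IsElliptic] [W.IsGloballyMinimal] (C : VariableChange ℚ),
        C • W = cm7.quadraticTwist (d : ℚ) → W.analyticRank = 1 →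
      ∀ (K : Type) [Field K] [NumberField K], IsImaginaryQuadratic K →
      ∀ (v vbar : HeightOneSpectrum (𝓞 K)),
        ((2 : ℕ) : 𝓞 K) ∈ v.asIdeal → ((2 : ℕ) : 𝓞 K) ∈ vbar.asIdeal → vbar ≠ v →
      ∀ (π : (W.baseChange K).endRing), (π : AddMonoid.End (W.baseChange K).geomPoints) * π = π - 2 →
      ∀ (r : ℤ_[2]), r * r = r - 2 →
        (∀ τ ∈ GreenbergSelmer.inertia v, ∀ x : ↥((W.baseChange K).endEigenPrimaryTorsion 2 π r), τ • x = x ∨ τ • x = -x) →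
      ∀ (κ' : ZpExtension K 2), κ'.IsUnramifiedOutside vbar → ∀ (γ' : absoluteGaloisGroup K), κ'.IsTopGenerator γ' →
      ∀ (P : W.toAffine.Point) (c₀ : ℕ) (ℓ : ℤ),
        ¬ IsOfFinAddOrder P →
        (∀ R : W.toAffine.Point, ∃ (k : ℤ) (T : W.toAffine.Point), IsOfFinAddOrder T ∧ R = k • P + T) →
        c₀ ≠ 0 → (W.baseChange ℚ_[2]).IsInReductionKernel (c₀ • W.toPadicPoint 2 P) →
        ‖(W.baseChange ℚ_[2]).padicLogPoint (c₀ • W.toPadicPoint 2 P) / (c₀ : ℚ_[2])‖ = (2 : ℝ) ^ (-ℓ) →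
      Finite (restrictedSelmerBase ↥((W.baseChange K).endEigenPrimaryTorsion 2 π r) 2 vbar) →
      Finite (endInvariants (conjRestricted κ' ↥((W.baseChange K).endEigenPrimaryTorsion 2 π r) vbar γ' - 1)) →
      ∀ (T : Finset (HeightOneSpectrum (𝓞 K))),
        (∀ w : HeightOneSpectrum (𝓞 K), w ∈ T ↔ ((2 : ℕ) : 𝓞 K) ∉ w.asIdeal ∧ ((7 * d : ℤ) : 𝓞 K) ∈ w.asIdeal) →
        (padicValNat 2 (Nat.card (restrictedSelmerBase ↥((W.baseChange K).endEigenPrimaryTorsion 2 π r) 2 vbar)) : ℤ) +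
          padicValNat 2 ((((restrictedSelmerBase ↥((W.baseChange K).endEigenPrimaryTorsion 2 π r) 2 vbar).map
              (resOfLe ↥((W.baseChange K).endEigenPrimaryTorsion 2 π r) (le_top : κ'.kerSubgroup ≤ ⊤))).addSubgroupOf
              (restrictedSelmerZp κ' ↥((W.baseChange K).endEigenPrimaryTorsion 2 π r) vbar)).relIndex
            (endInvariants (conjRestricted κ' ↥((W.baseChange K).endEigenPrimaryTorsion 2 π r) vbar γ' - 1))) -
          (∑ w ∈ T, padicValNat 2 (Nat.card (resOfLe ↥((W.baseChange K).endEigenPrimaryTorsion 2 π r)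
            (inf_le_inf_right (decomp w) (le_top : κ'.kerSubgroup ≤ ⊤))).ker) : ℕ) -
          padicValNat 2 (Nat.card (resOfLe ↥((W.baseChange K).endEigenPrimaryTorsion 2 π r)
            (inf_le_inf_right (decomp vbar) (le_top : κ'.kerSubgroup ≤ ⊤))).ker) =
        (padicValNat 2 (Nat.card (AddCommGroup.primaryComponent W.sha 2)) : ℤ) + 2 * ℓ + eK (d % 2) ((d / (2 - d % 2)) % 8)) :
    -- CONCLUSION: S3c `stub_restrictedControl_two`, v9 = v10.3 VERBATIM
    ∃ eC : ℤ → ℤ → ℤ,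
    ∀ (d : ℤ), d ≠ 0 → Squarefree d → d % 4 ≠ 1 →
    ∀ (W : WeierstrassCurve ℚ) [W.IsElliptic] [W.IsGloballyMinimal] (C : VariableChange ℚ),
      C • W = cm7.quadraticTwist (d : ℚ) → W.analyticRank = 1 →
    ∀ (K : Type) [Field K] [NumberField K], IsImaginaryQuadratic K →
    ∀ (v vbar : HeightOneSpectrum (𝓞 K)),
      ((2 : ℕ) : 𝓞 K) ∈ v.asIdeal → ((2 : ℕ) : 𝓞 K) ∈ vbar.asIdeal → vbar ≠ v →
    ∀ (π : (W.baseChange K).endRing), (π : AddMonoid.End (W.baseChange K).geomPoints) * π = π - 2 →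
    ∀ (r : ℤ_[2]), r * r = r - 2 →
      (∀ τ ∈ GreenbergSelmer.inertia v, ∀ x : ↥((W.baseChange K).endEigenPrimaryTorsion 2 π r), τ • x = x ∨ τ • x = -x) →
    ∀ (κ' : ZpExtension K 2), κ'.IsUnramifiedOutside vbar → ∀ (γ' : absoluteGaloisGroup K), κ'.IsTopGenerator γ' →
    ∀ (D : Agboola2007.RestrictedDualData κ' ↥((W.baseChange K).endEigenPrimaryTorsion 2 π r) vbar γ') (n : ℕ),
      Module.Finite (IwasawaAlgebra 2) D.X → D.HasCharValuationAt n →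
    ∀ (P : W.toAffine.Point) (c₀ : ℕ) (ℓ : ℤ),
      ¬ IsOfFinAddOrder P →
      (∀ R : W.toAffine.Point, ∃ (k : ℤ) (T : W.toAffine.Point), IsOfFinAddOrder T ∧ R = k • P + T) →
      c₀ ≠ 0 → (W.baseChange ℚ_[2]).IsInReductionKernel (c₀ • W.toPadicPoint 2 P) →
      ‖(W.baseChange ℚ_[2]).padicLogPoint (c₀ • W.toPadicPoint 2 P) / (c₀ : ℚ_[2])‖ = (2 : ℝ) ^ (-ℓ) →
      (n : ℤ) = ((padicValNat 2 (Nat.card (AddCommGroup.primaryComponent W.sha 2)) : ℤ)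
            + (padicValNat 2 W.tamagawaProduct : ℤ)
            - 2 * (padicValNat 2 W.torsionOrder : ℤ) + 2 * ℓ) + eC (d % 2) ((d / (2 - d % 2)) % 8) := by
  obtain ⟨ev, hev⟩ := hDy
  obtain ⟨eK, heK⟩ := hLev
  refine ⟨fun a b ↦ eK a b + ev a b, ?_⟩
  intro d hd0 hsq hd4 W _ _ C hC hrk K _ _ hK v vbar hv hvbar hne π hrel r hr hpin κ' hκ' γ' hγ' D n hDf hDn
    P c₀ ℓ hP hgen hc₀ hker hlog
  haveI : (W.baseChange K).IsElliptic := inferInstanceAs ((W.map (algebraMap ℚ K)).IsElliptic)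
  haveI := hDf
  -- 1. the four-index identity with all finiteness
  obtain ⟨hfinI, hfinC, hfinB, hfinK, hid⟩ :=
    hasCharValuationAt_control_identity_endEigenPrimaryTorsion (W.baseChange K) 2 π r κ' hγ' vbar D hDn
  -- 2. the kernel term: `#ker = 1` (H7)
  obtain ⟨w₇, h7w⟩ := exists_heightOneSpectrum_natCast_mem (K := K) (q := 7) (by norm_num)
  obtain ⟨-, hker0⟩ := natCard_ker_control_of_frame_eq_one hd0 W C hC hK vbar hvbar π hrel hr κ' hκ' h7w
    (hH7 K hK vbar hvbar κ' hκ' w₇ h7w)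
  -- 3. the top term: `#𝔖_Γ = 1` (R-TOP)
  have hcoinv : padicValNat 2 (Nat.card (EndCoinvariants (conjRestricted κ' ↥((W.baseChange K).endEigenPrimaryTorsion 2 π r) vbar γ' - 1))) = 0 := by
    rw [hTop d hd0 W C hC K hK v vbar hv hvbar hne π hrel r hr hpin κ' hκ' γ' hγ' D n hDf hDn, padicValNat_one_right]
  -- 4. the places `T` and the Tamagawa dictionary (C1; R-SEVEN for `7 ∣ d`), the torsion order
  obtain ⟨T, hT⟩ := exists_finset_seven_mul (K := K) hd0
  have hC1T : ∀ w ∈ T, ¬ decomp w ≤ κ'.kerSubgroup := fun w hw ↦ hC1 K hK vbar hvbar κ' hκ' w ((hT w).mp hw).1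
  have hTam : (∑ w ∈ T, padicValNat 2 (Nat.card (resOfLe ↥((W.baseChange K).endEigenPrimaryTorsion 2 π r) (inf_le_inf_right (decomp w) (le_top : κ'.kerSubgroup ≤ ⊤))).ker)) + 2 =
      padicValNat 2 W.tamagawaProduct ∧ W.torsionOrder = 2 := by
    by_cases h7 : (7 : ℤ) ∣ d
    · obtain ⟨htors, hlaw⟩ := hSeven d hsq hd4 h7 W C hC
      exact ⟨hlaw K hK vbar hvbar π hrel r hr κ' hκ' T hT hC1T, htors⟩
    · exact ⟨sum_padicValNat_localKer_top_of_frame_add_two_eq hsq hd4 h7 W C hC hK vbar hvbar π hrel hr κ' hκ' T hT hC1T,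
        torsionOrder_eq_two_of_smul_eq_cm7_quadraticTwist hsq hd4 h7 W C hC⟩
  obtain ⟨hTamEq, htors⟩ := hTam
  -- 5. the dyadic value and 6. the level-K law
  have hdy := hev d hd0 hsq hd4 W C hC K hK v vbar hv hvbar hne π hrel r hr hpin κ' hκ'
  have hlev := heK d hd0 hsq hd4 W C hC hrk K hK v vbar hv hvbar hne π hrel r hr hpin κ' hκ' γ' hγ' P c₀ ℓ hP hgen hc₀ hker hlog
    hfinB hfinI T hT
  -- 7. arithmetic
  have htors2 : (padicValNat 2 W.torsionOrder : ℤ) = 1 := by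
    rw [htors]; simp
  have hidZ : (n : ℤ) + (padicValNat 2 (Nat.card (EndCoinvariants (conjRestricted κ' ↥((W.baseChange K).endEigenPrimaryTorsion 2 π r) vbar γ' - 1))) : ℤ) +
      (padicValNat 2 (Nat.card ↥(restrictedSelmerBase ↥((W.baseChange K).endEigenPrimaryTorsion 2 π r) 2 vbar ⊓ (resOfLe ↥((W.baseChange K).endEigenPrimaryTorsion 2 π r) (le_top : κ'.kerSubgroup ≤ ⊤)).ker)) : ℤ) =
      (padicValNat 2 (Nat.card (restrictedSelmerBase ↥((W.baseChange K).endEigenPrimaryTorsion 2 π r) 2 vbar)) : ℤ) +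
        (padicValNat 2 ((((restrictedSelmerBase ↥((W.baseChange K).endEigenPrimaryTorsion 2 π r) 2 vbar).map (resOfLe ↥((W.baseChange K).endEigenPrimaryTorsion 2 π r) (le_top : κ'.kerSubgroup ≤ ⊤))).addSubgroupOf
          (restrictedSelmerZp κ' ↥((W.baseChange K).endEigenPrimaryTorsion 2 π r) vbar)).relIndex (endInvariants (conjRestricted κ' ↥((W.baseChange K).endEigenPrimaryTorsion 2 π r) vbar γ' - 1))) : ℤ) := by
    exact_mod_cast hid
  have hTamZ : ((∑ w ∈ T, padicValNat 2 (Nat.card (resOfLe ↥((W.baseChange K).endEigenPrimaryTorsion 2 π r) (inf_le_inf_right (decomp w)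
      (le_top : κ'.kerSubgroup ≤ ⊤))).ker) : ℕ) : ℤ) + 2 = (padicValNat 2 W.tamagawaProduct : ℤ) := by
    exact_mod_cast hTamEq
  rw [hker0] at hidZ
  rw [hcoinv] at hidZ
  dsimp only
  push_cast at hidZ hlev hTamZ hdy htors2 ⊢
  linarith

end Summit.BirchSwinnertonDyer.BirchSwinnertonDyer.Theorems.PrintCf2.RestrictedSelmerPair

end
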